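import Literature.AnabelianGeometry.AbsoluteAnabelian.MonoidKummerMapsMonoAnalyticLiftHolds
import Literature.AnabelianGeometry.AbsoluteAnabelian.MonoidKummerMapsUnitPairProofs
import Literature.AnabelianGeometry.AbsoluteAnabelian.MLFGaloisMonoAnalyticModel
import Literature.AnabelianGeometry.AbsoluteAnabelian.MLFGaloisPairsWitness
import HarnessLib

/-!
# [AbsTopIII] Prop. 3.3 (ii) AT THE GENUINE CARRIERS: the `TLG`/`TCG` lifting facts F-0412 / F-0413 for
# every MLF-Galois pair with PROFINITE (compact) `Π` — instances, no residual hypothesis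

S. Mochizuki, *Topics in Absolute Anabelian Geometry III*, Def. 3.1 (i)/(ii) pp. 66–67, Prop. 3.3 (ii) p. 74
(kurims `paper:url-5493eb38cbb7`); the author's *Comments on [AbsTopIII]* (2019) item (5).

abc-iut cell, D-0079 L-F sub-cell [AbsTop*]+[AbsAnab], row «LF-ABSTOP F-0412 F-0413» (abc-iut-L4-d3; L4-lead m24):
the unit of work of `plan/L4/LF-ABSTOP.tsv` is «the instance AT THE GENUINE [AbsTop*] DATA».  The named facts
F-0412 `UnitPairIsoFibres` / F-0413 `UnitPairIsoFibresOfType H` (abc-iut-L4-t2, `MonoidKummerMaps.lean`) quantify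
over ALL typed MLF-Galois pairs — including models whose `Π` carries, e.g., the discrete topology, for which the
closed F-0412 is equivalent to a Nikolov–Segal-type statement (abc-iut-L6-t21, `unitPairIsoFibres_iff_forall_continuous`).
Every GENUINE [AbsTopIII] datum has PROFINITE `Π` (the mono-analytic `G_k ↷ 𝒪_k̄^×`, `ModelMLFGaloisData.galois`; the
split models `G_k × Z`, `Z` profinite, `ModelMLFGaloisData.galProd`; every étale-`π₁` model), and for compact `Π` the
continuous surjection `ε : Π ↠ G_k` of Def. 3.1 (i) is automatically a quotient map — so the residual «open
augmentation / temperedness» hypothesis of the tranche closers (abc-iut-f-072 census 13:57:19Z) is DISCHARGED by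
compactness (abc-iut-w6's `ModelMLFGaloisData.exists_galoisContinuousMulEquiv_of_compactSpace`).  This PROOF-ONLY file
records the resulting instances (compositions of landed theorems):

* F-0412 conj. 2 (pre-erratum `TLG` two-lift clause) for ALL `TLG` pairs with compact `Π`:
  `unitPairIsoFibres_tlg_of_compactSpace` (`tlgLifting_compact_of_biAnabelianUnits` + `biAnabelianUnits_holds` +
  `unitPairIso_fibre_two_of_exists_lift`); packaged with the UNCONDITIONAL conj. 1 (abc-iut-L6-t21
  `unitPairIso_isoM_eq`) as `unitPairIsoFibres_of_compactSpace`;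
* at the mono-analytic type (no quotient-compatibility binder at all: `tlgLifting_monoAnalytic_holds`):
  `compactSpace_of_isOfMonoAnalyticTypeMonoid_tlg/_tcg`, `unitPairIsoFibres_tlg_of_isOfMonoAnalyticType`, and for
  the genuine pairs `G_{kᵢ} ↷ 𝒪^×_{k̄ᵢ}` of two MLF closures themselves `unitPairIsoFibres_tlg_galois`;
* at the split profinite models `unitPairIsoFibres_tlg_galProd`;
* F-0413 (the CORRECTED schema) AT the compactness predicate and at the mono-analytic predicate:
  `unitPairIsoFibresOfType_compactSpace_holds`, `unitPairIsoFibresOfType_monoAnalytic_holds` (one line each from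
  `unitPairIsoFibresOfType_of_compact_holds`).

HONEST LABEL (FACT-LIST R5): INSTANCE forms at the genuine profinite carriers, NOT the closed F-0412 over all typed
pairs; «of hyperbolic orbicurve type» as a GENUINE predicate is an E-list construction (the étale `π₁` of a curve) —
every such pair has profinite `Π`, so `unitPairIsoFibresOfType_compactSpace_holds` is the form its arrival
instantiates.  Classical (LCFT via [AbsAnab] Prop. 1.2.1 units transport); nothing here bears on [IUTchIII] Cor. 3.12
or asserts anything about abc.
-/

noncomputable section

open scoped nonZeroDivisors

namespace Literature.AnabelianGeometry.AbsoluteAnabelian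

/-! ### §1. F-0412 conj. 2 for every `TLG` pair with compact `Π` -/

/-- **[AbsTopIII] Prop. 3.3 (ii), `TLG` two-lift clause (F-0412 conj. 2) for ALL MLF-Galois `TLG`-pairs with
COMPACT underlying groups — unconditional**: over every `Π ⥲ Π*` respecting the arithmetic quotients there are
exactly two isomorphisms of pairs.  No open-augmentation binder: compactness makes every augmentation a quotient map.
[cite: MochizukiAbsTopIII2015, Proposition 3.3 (ii) p.74] -/
theorem unitPairIsoFibres_tlg_of_compactSpace (P Q : GaloisMonoidPair.{0}) (hP : IsMLFGaloisMonoidPair .TLG P)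
    (hQ : IsMLFGaloisMonoidPair .TLG Q) (hPc : CompactSpace P.Pi) (hQc : CompactSpace Q.Pi)
    (f : P.Pi ≃ₜ* Q.Pi) (hf : P.actionKer.map f.toMulEquiv.toMonoidHom = Q.actionKer) :
    ∃ e₁ e₂ : GaloisMonoidPair.Iso P Q, e₁.isoPi = f ∧ e₂.isoPi = f ∧ e₁.isoM ≠ e₂.isoM ∧
      ∀ e : GaloisMonoidPair.Iso P Q, e.isoPi = f → (e.isoM = e₁.isoM ∨ e.isoM = e₂.isoM) :=
  unitPairIso_fibre_two_of_exists_lift P Q hP f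
    (tlgLifting_compact_of_biAnabelianUnits biAnabelianUnits_holds P Q hP hQ hPc hQc f hf)

/-- **F-0412 `UnitPairIsoFibres` RESTRICTED TO COMPACT `Π` — both conjuncts**: conj. 1 (determination by the two
components) VERBATIM and unconditional (abc-iut-L6-t21 `unitPairIso_isoM_eq`); conj. 2 verbatim for the `TLG` pairs
with compact underlying groups. [cite: MochizukiAbsTopIII2015, Proposition 3.3 (ii) p.74] -/
theorem unitPairIsoFibres_of_compactSpace :
    (∀ (T : PairType) (P Q : GaloisMonoidPair.{0}), (T = .TLG ∨ T = .TCG) →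
      IsMLFGaloisMonoidPair T P → IsMLFGaloisMonoidPair T Q →
      ∀ e₁ e₂ : GaloisMonoidPair.Iso P Q, e₁.isoPi = e₂.isoPi →
        (∀ ζ : cyclotome P.M,
          Literature.AnabelianGeometry.EtaleTheta.cyclotome.map (Units.map e₁.isoM.toMonoidHom) ζ =
          Literature.AnabelianGeometry.EtaleTheta.cyclotome.map (Units.map e₂.isoM.toMonoidHom) ζ) →
        e₁.isoM = e₂.isoM) ∧
    (∀ (P Q : GaloisMonoidPair.{0}), IsMLFGaloisMonoidPair .TLG P → IsMLFGaloisMonoidPair .TLG Q →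
      CompactSpace P.Pi → CompactSpace Q.Pi →
      ∀ f : P.Pi ≃ₜ* Q.Pi, P.actionKer.map f.toMulEquiv.toMonoidHom = Q.actionKer →
        ∃ e₁ e₂ : GaloisMonoidPair.Iso P Q, e₁.isoPi = f ∧ e₂.isoPi = f ∧
        e₁.isoM ≠ e₂.isoM ∧ ∀ e : GaloisMonoidPair.Iso P Q, e.isoPi = f → (e.isoM = e₁.isoM ∨ e.isoM = e₂.isoM)) :=
  ⟨unitPairIso_isoM_eq, fun P Q hP hQ hPc hQc f hf => unitPairIsoFibres_tlg_of_compactSpace P Q hP hQ hPc hQc f hf⟩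

/-! ### §2. The mono-analytic type: `Π ≅ G_k` is compact; no quotient-compatibility binder -/

/-- Model data with bijective open augmentation have compact `Π` (`ε : Π ⥲ G_k` is then a homeomorphism onto the
profinite `G_k`). [cite: MochizukiAbsTopIII2015, Definition 3.1 (ii) p.67] -/
theorem ModelMLFGaloisData.compactSpace_of_bijective_isOpenMap (C : MLFClosure.{0}) (D : ModelMLFGaloisData C.k C.K)
    (hbij : Function.Bijective D.aug) (hopen : IsOpenMap D.aug) : CompactSpace D.Pi := by
  haveI : CompactSpace (C.K ≃ₐ[C.k] C.K) := inferInstance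
  let e : D.Pi ≃ₜ (C.K ≃ₐ[C.k] C.K) :=
    (Equiv.ofBijective D.aug hbij).toHomeomorphOfContinuousOpen D.continuous_aug hopen
  exact e.symm.compactSpace

/-- **An MLF-Galois `TLG`-pair of mono-analytic type has compact `Π`.** [cite: MochizukiAbsTopIII2015, Definition 3.1 (ii) p.67] -/
theorem compactSpace_of_isOfMonoAnalyticTypeMonoid_tlg {P : GaloisMonoidPair.{0}}
    (h : IsOfMonoAnalyticTypeMonoid .TLG P) : CompactSpace P.Pi := by
  obtain ⟨C, D, Q, ⟨hbij, hopen⟩, hQ, ⟨ι⟩⟩ := h.exists_model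
  rw [ModelMLFGaloisData.monoidPair_TLG, Option.some.injEq] at hQ
  subst hQ
  haveI : CompactSpace D.Pi := ModelMLFGaloisData.compactSpace_of_bijective_isOpenMap C D hbij hopen
  exact ι.isoPi.toHomeomorph.compactSpace

/-- **An MLF-Galois `TCG`-pair of mono-analytic type has compact `Π`.** [cite: MochizukiAbsTopIII2015, Definition 3.1 (ii) p.67] -/
theorem compactSpace_of_isOfMonoAnalyticTypeMonoid_tcg {P : GaloisMonoidPair.{0}}
    (h : IsOfMonoAnalyticTypeMonoid .TCG P) : CompactSpace P.Pi := by
  obtain ⟨C, D, Q, ⟨hbij, hopen⟩, hQ, ⟨ι⟩⟩ := h.exists_model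
  rw [ModelMLFGaloisData.monoidPair_TCG, Option.some.injEq] at hQ
  subst hQ
  haveI : CompactSpace D.Pi := ModelMLFGaloisData.compactSpace_of_bijective_isOpenMap C D hbij hopen
  exact ι.isoPi.toHomeomorph.compactSpace

/-- **F-0412 conj. 2 at the MONO-ANALYTIC type, with NO quotient-compatibility binder**: over EVERY isomorphism of
topological groups `Π ⥲ Π*` between MLF-Galois `TLG`-pairs of mono-analytic type there are exactly two isomorphisms
of pairs (`tlgLifting_monoAnalytic_holds`: LCFT units transport, [AbsAnab] Prop. 1.2.1).
[cite: MochizukiAbsTopIII2015, Proposition 3.3 (ii) p.74] -/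
theorem unitPairIsoFibres_tlg_of_isOfMonoAnalyticType (P Q : GaloisMonoidPair.{0})
    (hP : IsMLFGaloisMonoidPair .TLG P) (hQ : IsMLFGaloisMonoidPair .TLG Q)
    (hPm : IsOfMonoAnalyticTypeMonoid .TLG P) (hQm : IsOfMonoAnalyticTypeMonoid .TLG Q) (f : P.Pi ≃ₜ* Q.Pi) :
    ∃ e₁ e₂ : GaloisMonoidPair.Iso P Q, e₁.isoPi = f ∧ e₂.isoPi = f ∧ e₁.isoM ≠ e₂.isoM ∧
      ∀ e : GaloisMonoidPair.Iso P Q, e.isoPi = f → (e.isoM = e₁.isoM ∨ e.isoM = e₂.isoM) :=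
  unitPairIso_fibre_two_of_exists_lift P Q hP f (tlgLifting_monoAnalytic_holds P Q hP hQ hPm hQm f)

/-- **The GENUINE mono-analytic pairs `G_{k₁} ↷ 𝒪^×_{k̄₁}`, `G_{k₂} ↷ 𝒪^×_{k̄₂}` of two MLF closures**: over every
isomorphism of topological groups `G_{k₁} ⥲ G_{k₂}` there are exactly two isomorphisms of `TLG`-pairs.
[cite: MochizukiAbsTopIII2015, Proposition 3.3 (ii) p.74] -/
theorem unitPairIsoFibres_tlg_galois (C₁ C₂ : MLFClosure.{0})
    (f : (ModelMLFGaloisData.galois C₁.k C₁.K).tlgPair.Pi ≃ₜ* (ModelMLFGaloisData.galois C₂.k C₂.K).tlgPair.Pi) :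
    ∃ e₁ e₂ : GaloisMonoidPair.Iso (ModelMLFGaloisData.galois C₁.k C₁.K).tlgPair
        (ModelMLFGaloisData.galois C₂.k C₂.K).tlgPair,
      e₁.isoPi = f ∧ e₂.isoPi = f ∧ e₁.isoM ≠ e₂.isoM ∧
      ∀ e : GaloisMonoidPair.Iso (ModelMLFGaloisData.galois C₁.k C₁.K).tlgPair
          (ModelMLFGaloisData.galois C₂.k C₂.K).tlgPair,
        e.isoPi = f → (e.isoM = e₁.isoM ∨ e.isoM = e₂.isoM) :=
  unitPairIsoFibres_tlg_of_isOfMonoAnalyticType _ _ (isMLFGaloisMonoidPair_galois_tlgPair C₁)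
    (isMLFGaloisMonoidPair_galois_tlgPair C₂) (isOfMonoAnalyticTypeMonoid_galois_tlgPair C₁)
    (isOfMonoAnalyticTypeMonoid_galois_tlgPair C₂) f

/-! ### §3. The split profinite models `G_k × Z` -/

/-- **F-0412 conj. 2 at the split models `Π = G_{kᵢ} × Zᵢ`, `Zᵢ` compact** (abc-iut's `galProd`; e.g. `Zᵢ` a
profinite completion of a surface group). [cite: MochizukiAbsTopIII2015, Proposition 3.3 (ii) p.74] -/
theorem unitPairIsoFibres_tlg_galProd (C₁ C₂ : MLFClosure.{0}) (Z₁ Z₂ : Type) [Group Z₁] [TopologicalSpace Z₁]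
    [IsTopologicalGroup Z₁] [CompactSpace Z₁] [Group Z₂] [TopologicalSpace Z₂] [IsTopologicalGroup Z₂] [CompactSpace Z₂]
    (f : (ModelMLFGaloisData.galProd C₁ Z₁).tlgPair.Pi ≃ₜ* (ModelMLFGaloisData.galProd C₂ Z₂).tlgPair.Pi)
    (hf : (ModelMLFGaloisData.galProd C₁ Z₁).tlgPair.actionKer.map f.toMulEquiv.toMonoidHom =
      (ModelMLFGaloisData.galProd C₂ Z₂).tlgPair.actionKer) :
    ∃ e₁ e₂ : GaloisMonoidPair.Iso (ModelMLFGaloisData.galProd C₁ Z₁).tlgPair (ModelMLFGaloisData.galProd C₂ Z₂).tlgPair,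
      e₁.isoPi = f ∧ e₂.isoPi = f ∧ e₁.isoM ≠ e₂.isoM ∧
      ∀ e : GaloisMonoidPair.Iso (ModelMLFGaloisData.galProd C₁ Z₁).tlgPair (ModelMLFGaloisData.galProd C₂ Z₂).tlgPair,
        e.isoPi = f → (e.isoM = e₁.isoM ∨ e.isoM = e₂.isoM) := by
  haveI : CompactSpace (C₁.K ≃ₐ[C₁.k] C₁.K) := inferInstance
  haveI : CompactSpace (C₂.K ≃ₐ[C₂.k] C₂.K) := inferInstance
  exact unitPairIsoFibres_tlg_of_compactSpace _ _ (isMLFGaloisMonoidPair_tlgPair C₁ _)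
    (isMLFGaloisMonoidPair_tlgPair C₂ _) (inferInstanceAs (CompactSpace ((C₁.K ≃ₐ[C₁.k] C₁.K) × Z₁)))
    (inferInstanceAs (CompactSpace ((C₂.K ≃ₐ[C₂.k] C₂.K) × Z₂))) f hf

/-! ### §4. F-0413 (the corrected schema) at the genuine predicates -/

/-- **F-0413 `UnitPairIsoFibresOfType` AT THE COMPACTNESS PREDICATE — unconditional**: the corrected Prop. 3.3 (ii)
(`TCG` bijection, `TLG` two-lift) for all pairs with profinite `Π`.
[cite: MochizukiAbsTopIII2015, Proposition 3.3 (ii) p.74] [cite: MochizukiAbsTopIIIComments2019, item (5)] -/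
theorem unitPairIsoFibresOfType_compactSpace_holds :
    Literature.AnabelianGeometry.AbsoluteAnabelian.UnitPairIsoFibresOfType (fun P => CompactSpace P.Pi) :=
  unitPairIsoFibresOfType_of_compact_holds _ fun _ h => h

/-- **F-0413 at the MONO-ANALYTIC predicate — unconditional** (every pair of mono-analytic type has compact `Π`).
[cite: MochizukiAbsTopIII2015, Proposition 3.3 (ii) p.74] [cite: MochizukiAbsTopIIIComments2019, item (5)] -/
theorem unitPairIsoFibresOfType_monoAnalytic_holds :
    Literature.AnabelianGeometry.AbsoluteAnabelian.UnitPairIsoFibresOfType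
      (fun P => IsOfMonoAnalyticTypeMonoid .TLG P ∨ IsOfMonoAnalyticTypeMonoid .TCG P) :=
  unitPairIsoFibresOfType_of_compact_holds _ fun _ h =>
    h.elim compactSpace_of_isOfMonoAnalyticTypeMonoid_tlg compactSpace_of_isOfMonoAnalyticTypeMonoid_tcg

/-- **F-0413 at the predicate «isomorphic to a model pair with profinite `Π`»** (the shape an étale-`π₁` carrier
arrives in). [cite: MochizukiAbsTopIII2015, Proposition 3.3 (ii) p.74] -/
theorem unitPairIsoFibresOfType_profiniteModel_holds :
    Literature.AnabelianGeometry.AbsoluteAnabelian.UnitPairIsoFibresOfType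
      (fun P => ∃ (C : MLFClosure.{0}) (D : ModelMLFGaloisData C.k C.K), CompactSpace D.Pi ∧
        (Nonempty (GaloisMonoidPair.Iso D.tlgPair P) ∨ Nonempty (GaloisMonoidPair.Iso D.tcgPair P))) :=
  unitPairIsoFibresOfType_of_compact_holds _ fun _ ⟨_, D, hD, h⟩ => by
    haveI := hD
    rcases h with ⟨⟨ι⟩⟩ | ⟨⟨ι⟩⟩
    · exact ι.isoPi.toHomeomorph.compactSpace
    · exact ι.isoPi.toHomeomorph.compactSpace

end Literature.AnabelianGeometry.AbsoluteAnabelian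

end

/-! ### Reconciliation with the Summits-side universal witnesses (abc-iut-L4-lead m29 (3))

The CLOSED forms are PROVED in the tree, unconditionally, on the Summits side (which this Literature file cannot
import): `Summit.ABC.IUTFork.unitPairIsoFibres_holds : UnitPairIsoFibres` (F-0412, both conjuncts, ALL typed
MLF-Galois `TLG`/`TCG`-pairs), `Summit.ABC.IUTFork.unitPairIsoFibresOfType_holds (H)` (F-0413, every `H`) and
`Summit.ABC.IUTFork.galoisIsoLiftsToTMPairIso_holds (H)` (F-0409), in
`Summits/ABC/IUTFork/MLFGaloisStronglyCompleteUnconditional.lean` (p445855: the Nikolov–Segal-type input — every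
finite-index subgroup of `G_k` is open, `k` an MLF — PROVED there at `G_k`, whence the abstract bi-anabelian units
statement and the lifting sentences with NO compactness/open-augmentation hypothesis).  So the sentence «the closed
F-0412 over all typed pairs stays ⟺ a Nikolov–Segal-type statement» in the header above describes the
LITERATURE-SIDE status only; the value of the present file is PLACEMENT (instances importable from `Literature/`,
at the genuine profinite carriers, by elementary compactness), not strength. [cite: MochizukiAbsTopIII2015, Proposition 3.3 (ii) p.74] -/
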